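import Summits.MatrixMultiplication.OmegaCensus.STPPVosperSlackTwoCheckersT
import Summits.MatrixMultiplication.OmegaCensus.STPPVosperSlackTwoTablesZ59
import Summits.MatrixMultiplication.OmegaCensus.STPPVosperSlackTwoLawABQ

/-!
# ω-census (abelian STPP census): ℤ₅₉ leaf L3 = {(2,3,3),(2,3,4),(3,2,3)} — slack-2 three-block law, case A rows up to dihedral symmetry, part 4 of 4 (kernel computations)

HONEST FRAMING (pub-omega census; verbatim): lottery ticket; floor = certified bounds/negative ranges.
Census STRUCTURE (seat pub-omega-stpp-2 gen 27 — rows service for the stpp-1 lineage's law, 2026-08-29), family (b2).  Rows for stpp-1 g33's three-block slack-2 law (checker `caseADeadT` of `STPPVosperSlackTwoCheckersT.lean`, dead table `tblZ59L3A` of `…TablesZ59.lean`; block i = the (2,3,4) block read directly, others (2,3,3),(3,2,3), L = z = 15): `dihedralSmaller 59 Q || caseADeadT 59 2 4 15 15 Q tblZ59L3A` over `qShapes 59 3` (dihedral representatives only; stpp-1 g33 mirror 152 118 nodes; farm calibration ≈ 1.2 ms per node).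
Each theorem is ONE `decide +kernel` over one chunk (sized by a python cost mirror to stay under the default-heartbeat ceiling).
Assembly in `STPPVosperSlackTwoRows59L3AAsm.lean`.  Nothing here is progress on `ω`.
-/

namespace Summit.MatrixMultiplication.OmegaCensus.CubeNB.S2

/-- Rows chunk `[1624, 1653)`: every entry passes the kernel test. [folklore] -/
theorem rows59L3A_c18 : ((qShapes 59 3 1624 1653).all fun Q => dihedralSmaller 59 Q || caseADeadT 59 2 4 15 15 Q tblZ59L3A) = true := by
  decide +kernel

end Summit.MatrixMultiplication.OmegaCensus.CubeNB.S2
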